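import Summits.Ventures.HSemireg.WedgeHankelRecurrenceStrelitz

/-!
# Venture HSemireg — THE GENERIC CASE OF BPR §9.3 IN STRELITZ'S TERMS: for a real `p ≠ 0`, **`p ⊥ p(−X)` (the hypothesis of N189/N190/N197) ⟺ no two roots of `p` sum to zero ⟺ `p(0) ≠ 0 ∧ q(0) ≠ 0`**,
# where `q = strelitz p` is the pair-sum polynomial of N199 (`q(0) = ± Π_{i<j} (z_i + z_j)`, Orlando's product); in particular Strelitz positivity, or Hurwitz stability, puts `p` in the generic case

HONEST FRAMING. Part of the Lean index of the computation cell `pub-hsemireg` (seat p10 gen 38, Sunday typer «UNIFORM-IN-n»).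
POLYNOMIAL ALGEBRA OVER `ℂ` AND `ℝ` AND MULTISETS ONLY: no variety, no cohomology theory, no sheaf, no Ext group and no semiregularity map is constructed here; nothing here says that HC /
HC_CM / HC_AV holds; no Literature fact (unproved `Prop`) is declared or used.  Custodian versions as in `WedgeHankelSiegelIdeal` (1/3).
SOURCE (cited; held text read): S. Basu, R. Pollack, M.-F. Roy (2006) §9.3 p. 344 (chunk p0368) — the Routh–Hurwitz/Liénard–Chipart statements (Thm 9.29–9.31) are proved in the GENERIC case
«`P(X)` and `P(−X)` are coprime» (typed as `IsCoprime p (p.comp (−X))` in N189 `forall_re_neg_iff_posDef_bezoutian_and_of_even/odd`, N190, N197); V. V. Prasolov, Polynomials §1.1.5 Thm 1.1.14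
(chunks p0017–p0018): the pair-sum polynomial `q` (N199 `strelitz`).  THIS FILE (elementary, no printed locus claimed beyond these): over `ℂ`, `p ⊥ p(−X)` iff `p` and `p(−X)` have no common
root iff no two roots (possibly equal) sum to `0`; splitting the diagonal (`2z = 0 ⟺ z = 0 ⟺ p(0) = 0`) from the off-diagonal pairs (`z_i + z_j = 0`, `i < j` ⟺ `q(0) = 0`) gives the
dictionary with N199; L. Orlando (1911)'s `Δ_{n−1} = ± lc^{n−1} Π_{i<j}(z_i + z_j)` is the classical reading of `q(0)` (NOT typed: no Hurwitz matrix in the tree).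
DEDUP DISCLOSURE (`rg` of the whole tree + Mathlib, 2026-09-02): N185 `isCoprime_map_conj_comp_neg_X_iff` is the CONJUGATE-mirror form `p ⊥ p̄(−X) ↔ (z root ⇒ −z̄ not)`; N186
`isCoprime_of_forall_re_neg` (complex, mirror form); N187 `isCoprime_map_ofReal_iff` (real ↔ complex transfer).  The plain forms below (`p ⊥ p(−X)` over `ℂ`, root-sum language, `q(0)`) are
new.  9 names: 0 hits tree-wide + Mathlib.

WHAT IS IN THE TREE.  N199: `offDiagPairSums`, `mem_offDiagPairSums_iff`, `strelitz`, `roots_strelitz`, `strelitz_monic`, `strelitz_necessity`; N187: `isCoprime_map_ofReal_iff`; Literature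
`HermiteRealRootedness.map_conj_aroots`; Mathlib: `Polynomial.isCoprime_iff_aeval_ne_zero_of_isAlgClosed`, `eval_multiset_prod`, `Multiset.prod_eq_zero_iff`, `coeff_zero_eq_eval_zero`.
THIS FILE (namespace `Summit.Ventures.HSemireg.Wedge.HankelOuter` continued; CHAINED on N199; 0 definitions):
* §889 `isCoprime_comp_neg_X_iff_forall_roots` (complex `p ≠ 0`: `p ⊥ p(−X) ↔ ∀ z w ∈ roots, z + w ≠ 0`), `forall_add_ne_zero_iff` (multisets over a char-0 field: `… ↔ 0 ∉ s ∧ 0 ∉ offDiagPairSums s`),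
  `isCoprime_comp_neg_X_real_iff_forall_roots` (real `p`).
* §890 `eval_zero_strelitz` (`q(0) = Π (−(z_i + z_j))`), `strelitz_eval_zero_ne_zero_iff` (`q(0) ≠ 0 ↔ 0 ∉ offDiagPairSums(roots)`), `coeff_zero_ne_zero_iff_zero_notMem_roots`,
  **`isCoprime_comp_neg_X_iff_strelitz`** (`p ⊥ p(−X) ↔ p(0) ≠ 0 ∧ q(0) ≠ 0`), `isCoprime_comp_neg_X_of_strelitz_pos` (Strelitz positivity ⇒ generic case).
CAVEATS.  `q(0)` is a complex number with zero imaginary part (N199 `im_coeff_strelitz` at `k = 0` via `coeff_zero_eq_eval_zero`); Orlando's determinant formula itself is not typed.  Nothing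
Ext-side.  New names only.
-/

open Polynomial
open scoped Polynomial ComplexConjugate

namespace Summit.Ventures.HSemireg.Wedge.HankelOuter

/-! ## §889. `p ⊥ p(−X)` in the language of root sums -/

/-- **Over `ℂ`, `p ⊥ p(−X)` iff no two roots of `p` (possibly the same root twice) sum to zero** (`p ≠ 0`). [BPR §9.3 generic case; this file §889] -/
theorem isCoprime_comp_neg_X_iff_forall_roots {p : ℂ[X]} (hp0 : p ≠ 0) : IsCoprime p (p.comp (-X)) ↔ ∀ z ∈ p.roots, ∀ w ∈ p.roots, z + w ≠ 0 := by
  rw [Polynomial.isCoprime_iff_aeval_ne_zero_of_isAlgClosed (k := ℂ) (K := ℂ) p (p.comp (-X))]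
  simp only [Polynomial.coe_aeval_eq_eval, eval_comp, eval_neg, eval_X]
  constructor
  · intro h z hz w hw hzw
    have hw' : w = -z := by linear_combination hzw
    rcases h z with h1 | h1
    · exact h1 ((mem_roots hp0).1 hz).eq_zero
    · rw [← hw'] at h1
      exact h1 ((mem_roots hp0).1 hw).eq_zero
  · intro h z
    by_cases hz : p.eval z = 0
    · right
      intro hz'
      exact h z ((mem_roots hp0).2 hz) (-z) ((mem_roots hp0).2 hz') (add_neg_cancel z)
    · exact Or.inl hz

/-- **For a multiset `s` over a field of characteristic zero: no two members (possibly equal) sum to zero iff `0 ∉ s` and `0 ∉ offDiagPairSums s`** (the diagonal `z + z = 0` means `z = 0`).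
[this file §889] -/
theorem forall_add_ne_zero_iff {K : Type*} [Field K] [CharZero K] (s : Multiset K) : (∀ z ∈ s, ∀ w ∈ s, z + w ≠ 0) ↔ (0 : K) ∉ s ∧ (0 : K) ∉ offDiagPairSums s := by
  classical
  constructor
  · intro h
    refine ⟨fun h0 => h 0 h0 0 h0 (add_zero 0), fun h0 => ?_⟩
    obtain ⟨a, ha, b, hb, hab⟩ := mem_offDiagPairSums_iff.1 h0
    exact h a ha b (Multiset.mem_of_le (Multiset.erase_le _ _) hb) hab
  · rintro ⟨h0, hT⟩ z hz w hw hzw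
    by_cases hzw' : w = z
    · subst hzw'
      have : w = 0 := by linear_combination hzw / 2
      exact h0 (this ▸ hz)
    · exact hT (hzw ▸ add_mem_offDiagPairSums hz ((Multiset.mem_erase_of_ne hzw').2 hw))

/-- **Real form: for a real `p ≠ 0`, `p ⊥ p(−X)` iff no two complex roots of `p` sum to zero.** [BPR §9.3 generic case; this file §889] -/
theorem isCoprime_comp_neg_X_real_iff_forall_roots {p : ℝ[X]} (hp0 : p ≠ 0) :
    IsCoprime p (p.comp (-X)) ↔ ∀ z ∈ (p.map (algebraMap ℝ ℂ)).roots, ∀ w ∈ (p.map (algebraMap ℝ ℂ)).roots, z + w ≠ 0 := by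
  have hconj : (p.map (algebraMap ℝ ℂ)).map (starRingEnd ℂ) = p.map (algebraMap ℝ ℂ) := by
    rw [Polynomial.map_map]
    congr 1
    ext r
    simp
  rw [← isCoprime_map_ofReal_iff p, hconj, isCoprime_comp_neg_X_iff_forall_roots ((Polynomial.map_ne_zero_iff (RingHom.injective _)).2 hp0)]

/-! ## §890. `p ⊥ p(−X) ⟺ p(0) ≠ 0 ∧ q(0) ≠ 0` -/

/-- **`q(0) = Π_{i<j} (−(z_i + z_j))`** (Orlando's product up to sign). [this file §890] -/
theorem eval_zero_strelitz (p : ℝ[X]) : (strelitz p).eval 0 = ((offDiagPairSums (p.map (algebraMap ℝ ℂ)).roots).map fun w => -w).prod := by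
  rw [strelitz, eval_multiset_prod, Multiset.map_map]
  congr 1
  exact Multiset.map_congr rfl fun w _ => by simp

/-- **`q(0) ≠ 0 ⟺ 0 ∉ offDiagPairSums(roots p)`** (no two roots at different positions sum to zero). [this file §890] -/
theorem strelitz_eval_zero_ne_zero_iff (p : ℝ[X]) : (strelitz p).eval 0 ≠ 0 ↔ (0 : ℂ) ∉ offDiagPairSums (p.map (algebraMap ℝ ℂ)).roots := by
  rw [eval_zero_strelitz, Ne, Multiset.prod_eq_zero_iff, Multiset.mem_map]
  constructor
  · rintro h h0
    exact h ⟨0, h0, neg_zero⟩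
  · rintro h ⟨w, hw, hw0⟩
    rw [neg_eq_zero] at hw0
    exact h (hw0 ▸ hw)

/-- `p(0) ≠ 0 ⟺ 0` is not a complex root (`p ≠ 0`). [bookkeeping; this file §890] -/
theorem coeff_zero_ne_zero_iff_zero_notMem_roots {p : ℝ[X]} (hp0 : p ≠ 0) : p.coeff 0 ≠ 0 ↔ (0 : ℂ) ∉ (p.map (algebraMap ℝ ℂ)).roots := by
  rw [mem_roots ((Polynomial.map_ne_zero_iff (RingHom.injective _)).2 hp0), IsRoot.def, ← coeff_zero_eq_eval_zero, coeff_map, Complex.coe_algebraMap, Complex.ofReal_eq_zero]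

/-- **THE DICTIONARY: for a real `p ≠ 0`, `p ⊥ p(−X) ⟺ p(0) ≠ 0 ∧ q(0) ≠ 0`** (`q = strelitz p`): BPR's generic case is the non-vanishing of the constant terms of `p` and of its pair-sum
polynomial. [BPR §9.3 + Prasolov Thm 1.1.14; this file §890] -/
theorem isCoprime_comp_neg_X_iff_strelitz {p : ℝ[X]} (hp0 : p ≠ 0) : IsCoprime p (p.comp (-X)) ↔ p.coeff 0 ≠ 0 ∧ (strelitz p).eval 0 ≠ 0 := by
  rw [isCoprime_comp_neg_X_real_iff_forall_roots hp0, forall_add_ne_zero_iff, coeff_zero_ne_zero_iff_zero_notMem_roots hp0, strelitz_eval_zero_ne_zero_iff]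

/-- **Strelitz positivity puts `p` in the generic case**: if all `p_k > 0` (`k ≤ deg p`) and all coefficients of `q` are positive then `p ⊥ p(−X)`. [this file §890] -/
theorem isCoprime_comp_neg_X_of_strelitz_pos {p : ℝ[X]} (hpos : ∀ k ≤ p.natDegree, 0 < p.coeff k) (hq : ∀ k ≤ (strelitz p).natDegree, 0 < ((strelitz p).coeff k).re) :
    IsCoprime p (p.comp (-X)) := by
  have hp0 : p ≠ 0 := fun h0 => by have := hpos p.natDegree le_rfl; rw [h0, coeff_zero] at this; exact lt_irrefl _ this
  refine (isCoprime_comp_neg_X_iff_strelitz hp0).2 ⟨(hpos 0 (Nat.zero_le _)).ne', fun h0 => ?_⟩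
  have := hq 0 (Nat.zero_le _)
  rw [coeff_zero_eq_eval_zero, h0, Complex.zero_re] at this
  exact lt_irrefl _ this

/-- **A real Hurwitz polynomial with `lc(p) > 0` is in the generic case `p ⊥ p(−X)`** (real counterpart of N186 `isCoprime_of_forall_re_neg`, here via Strelitz positivity). [this file §890] -/
theorem isCoprime_comp_neg_X_of_forall_re_neg_real {p : ℝ[X]} (hlc : 0 < p.leadingCoeff) (h : ∀ z ∈ (p.map (algebraMap ℝ ℂ)).roots, z.re < 0) : IsCoprime p (p.comp (-X)) :=
  isCoprime_comp_neg_X_of_strelitz_pos (strelitz_necessity hlc h).1 (strelitz_necessity hlc h).2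

end Summit.Ventures.HSemireg.Wedge.HankelOuter
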